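import Literature.MathematicalPhysics.QuantumFieldTheory.Balaban1983to89.B5Eq129FreeResolventDecayedLetter
import Literature.MathematicalPhysics.QuantumFieldTheory.Balaban1983to89.B9Eq342CoshWeightSite

/-!
# `Balaban1983to89.B5Eq129FreeResolventDecayedLetterSite` — T. Bałaban, *Propagators and renormalization transformations for lattice gauge theories. I*,
# Commun. Math. Phys. **95** (1984) 17–40 [Balaban1984PropagatorsI] (1.29)∕(1.31) p. 23, Prop. 1.1 p. 33, p. 36, with *Propagators for lattice gauge theories
# in a background field*, Commun. Math. Phys. **99** (1985) 389–434 [Balaban1985BackgroundPropagators] (3.1) p. 390, (3.11) p. 392, Thm 3.1 (3.42) p. 397: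
# **(D-FS) ON THE CHAIN's LATTICE — the decayed free letter `φ_k(x₀) ≤ √(ḡ_k·λ^{−k}·W(x₀)∕c₀)·√(Σ_y c₀φ₀(y)²∕W(y))` of ne9-leaf-02 g71's
# `B5Eq129FreeResolventDecayedLetter` TRANSPORTED from b05's torus `Tor P` (steps `± e_ν`) to `TSite d P` (steps `shift`∕`unshift`, the
# `Sum.elim unshift shift` graph form of the bootstrap), for ANY supersolution weight and, BY NAME, for the `cosh` weight of `B9Eq342CoshWeightSite`
# centred at `x₀` — LITERALLY the binder `hDFS` of the (D-A) assembly `B9Eq342GreenPrimeSupBoundDecay` at `t = η⁻¹`, `m = 1`** (NE9 owner's SUP-NORM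
# PROGRAMME, plan v10 §5 (D-FS)∕(D-A); the level-free value of `ḡ_k` for `k ≥ d` is leaf-02's `B5Eq129FreeResolventZoneSumLetters.entry_const(_diag)_le`)

statement-level skeleton of published theorems with citation tags; proofs where landed; nothing here is a claim about the Yang–Mills mass gap

CITATION HEADER (lean-in-tree rule).  Audit cell `pub-balaban`, sub-cell `t4`, BINDER row NE9; filed by the row OWNER lineage `b2b-balaban-t4-ne9-p1` (gen 90)
on the (D-A) assembly's last displayed analytic letter (first refusal on the FILING offered to ne9-leaf-02, the (D-FS) author, journal [NE9P1-G90-ONLINE] W-2).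
Sources as quoted verbatim in `B5Eq129FreeResolventDecayedLetter` and `B5Eq129FreeResolventSupBoundSites`: [Balaban1985BackgroundPropagators] p. 390 (3.1)
(the periodic lattice), p. 397 Thm 3.1 (3.42) *«… ≤ B₀e^{−δ₀d(y,y′)} …»*; [Balaban1984PropagatorsI] (1.29) p. 23, p. 36.  MECHANISM ([folklore]): the site
dictionary `x ↦ (x_μ mod P_μ)_μ` is a bijection carrying `shift`∕`unshift` to `± e_ν` (`B9Eq342CoshWeightSite.cast_bijective ∕ cast_shift ∕ cast_unshift`),
so chains, weights and sums are transported verbatim.  NOTHING printed is used as a hypothesis; `[cite: …]` tags are TEXT LOCATIONS (ABSOLUTE RULE).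

WHAT IS PROVED (sorry-free; 0 `def`).  `P : Fin d → ℕ` positive; `t`, `0 < m`, `0 < c₀`; chains in the graph form `Σ_{j : Fin d ⊕ Fin d} t²(φ_{j+1}(x) −
φ_{j+1}(nbr(x,j))) + m·φ_{j+1}(x) = φ_j(x)`, `nbr(x,·) = Sum.elim (unshift · x) (shift · x)`.
* `sum_sumElim_eq'` (re-bracketing), **`chain_apply_le_weighted_site`** (any weight `W > 0`, `λW ≤ (L₀+m)W` in graph form, `0 < λ`:
  `φ_k(x₀) ≤ √(ḡ_k·λ^{−k}·W(x₀)∕c₀)·√(Σ_y c₀φ₀(y)²∕W(y))`, `ḡ_k = |T|⁻¹Σ_{p ∈ Tor P}(Δ_t(p)+m)^{−k}`);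
* **`chain_apply_le_cosh_site`** (the `cosh` weight centred at `x₀`: `W(x₀) = 1`, `λ = m − 2d·t²(cosh a − 1) > 0` a HYPOTHESIS, inhabited by
  `B9Eq342CoshWeightSite.exists_rate`); **`hDFS_cosh_site`** — at `t = η⁻¹`, `m = 1`: the binder `hDFS` of `norm_GpOfU_apply_le_decay ∕ _rowSum` with
  `C₃ = √(ḡ_k·λ^{−k}∕c₀)`, for every `k` (level-free for `k ≥ d` after leaf-02's `entry_const_diag_le`: `ḡ_k∕c₀ ≤ 3^d∕c₁`);
* `symbolSum_div_card_le` (`ḡ_k ≤ m^{−k}`, crude, VOLUME-FREE) and **`hDFS_cosh_site'`** (the same binder with the `Tor`-free constant `C₃ = √(λ^{−k}∕c₀)`).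
HONEST SCOPE.  Transport only; FREE flat stencil (no background, no `Q′*Q′`); nothing of [B9] Thm 3.1 ∕ [B5] Prop. 1.1 asserted or valued.  NOT summit
progress (cell pub-balaban: NE9 NOT PRINTED ∕ NOT PROVED; «NE9 ⇐ the named binders»; row WALLED ON A MODEL (O-NE9-1; #5 UNRULED); spine PROVED 0∕9; rung
(B)+1 finite T⁴ — NOT infinite volume, NOT mass gap, NOT BetaPertH, NOT Clay).  HONEST DEPENDENCY (cell line): continuum YM on T⁴ ⇐ BetaPertH ∧ nine spine
estimates (0/9 proved); BetaPertH ⇐ (D1) ∧ (D4) ∧ CAP+tail; G-an2-4 gates asym, D1 and NE2/3/4.  NEW file importing `B5Eq129FreeResolventDecayedLetter` +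
`B9Eq342CoshWeightSite`; nothing modified.  Net new unproved facts: 0.
-/

noncomputable section

open scoped BigOperators

namespace Literature.MathematicalPhysics.QuantumFieldTheory.Balaban1983to89.B5Eq129FreeResolventDecayedLetterSite

open B4Sect5Torus (TSite)
open B9SectCLatticeCarrier (shift unshift)
open B5Prop11Plancherel (Tor chi unitVec)
open B4TorusKernel.MultiPeriod (circAbs)
open B5Eq129FreeResolventSupBound (symbol_nonneg)
open B5Eq129FreeResolventDecayedLetter (chain_apply_le_weighted)
open B9Eq342CoshWeightSite (cast_bijective cast_shift cast_unshift weight_site_pos weight_site_centre weight_site_supersolution)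

variable {d : ℕ} (P : Fin d → ℕ) [hP : ∀ i, NeZero (P i)]

omit hP in
/-- Re-bracketing: the `Σ_{j : Fin d ⊕ Fin d}` form over `Sum.elim (unshift · x) (shift · x)` IS the `Σ_ν [· + ·]` form. [folklore]
[cite: Balaban1985BackgroundPropagators, (3.23) p.394] -/
theorem sum_sumElim_eq' (t : ℝ) (φ : TSite d P → ℝ) (x : TSite d P) :
    ∑ j : Fin d ⊕ Fin d, t ^ 2 * (φ x - φ (Sum.elim (fun μ => unshift μ x) (fun μ => shift μ x) j)) =
      ∑ ν, t ^ 2 * ((φ x - φ (unshift ν x)) + (φ x - φ (shift ν x))) := by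
  rw [Fintype.sum_sum_type, ← Finset.sum_add_distrib]
  exact Finset.sum_congr rfl fun ν _ => by simp only [Sum.elim_inl, Sum.elim_inr]; ring

/-- **(D-FS) ON `TSite d P`, ANY SUPERSOLUTION WEIGHT**: `0 < m`, `0 < c₀`, `0 < λ`, `W > 0` with `λW ≤ (L₀+m)W` in the graph form, a `k`-chain `φ` in
the graph form ⟹ `φ_k(x₀) ≤ √(ḡ_k·λ^{−k}·W(x₀)∕c₀)·√(Σ_y c₀φ₀(y)²∕W(y))` — `B5Eq129FreeResolventDecayedLetter.chain_apply_le_weighted` carried along the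
site dictionary. [cite: Balaban1985BackgroundPropagators, Thm 3.1 (3.42) p.397, (3.11) p.392, (3.1) p.390; Balaban1984PropagatorsI, (1.29) p.23, Prop. 1.1 p.33] -/
theorem chain_apply_le_weighted_site (t : ℝ) {m c₀ lam : ℝ} (hm : 0 < m) (hc₀ : 0 < c₀) (hlam : 0 < lam)
    {W : TSite d P → ℝ} (hW : ∀ y, 0 < W y)
    (hsup : ∀ y, lam * W y ≤ ∑ j : Fin d ⊕ Fin d, t ^ 2 * (W y - W (Sum.elim (fun ν => unshift ν y) (fun ν => shift ν y) j)) + m * W y)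
    {k : ℕ} {φ : ℕ → TSite d P → ℝ}
    (hφ : ∀ j < k, ∀ x, ∑ i : Fin d ⊕ Fin d, t ^ 2 * (φ (j + 1) x - φ (j + 1) (Sum.elim (fun ν => unshift ν x) (fun ν => shift ν x) i)) +
      m * φ (j + 1) x = φ j x) (x₀ : TSite d P) :
    φ k x₀ ≤ Real.sqrt ((∑ p : Tor P, (((∑ ν, t ^ 2 * (2 - 2 * (chi P p (unitVec P ν)).re)) + m) ^ k)⁻¹) / Fintype.card (Tor P) *
        (lam ^ k)⁻¹ * W x₀ / c₀) * Real.sqrt (∑ y, c₀ * φ 0 y ^ 2 / W y) := by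
  set e : TSite d P ≃ Tor P := Equiv.ofBijective _ (cast_bijective P) with he
  have hsh : ∀ ν (y : TSite d P), e (shift ν y) = e y + unitVec P ν := fun ν y => cast_shift P ν y
  have hush : ∀ ν (y : TSite d P), e (unshift ν y) = e y - unitVec P ν := fun ν y => cast_unshift P ν y
  have hsh' : ∀ ν (z : Tor P), e.symm (z + unitVec P ν) = shift ν (e.symm z) := fun ν z =>
    e.injective (by rw [Equiv.apply_symm_apply, hsh, Equiv.apply_symm_apply])
  have hush' : ∀ ν (z : Tor P), e.symm (z - unitVec P ν) = unshift ν (e.symm z) := fun ν z =>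
    e.injective (by rw [Equiv.apply_symm_apply, hush, Equiv.apply_symm_apply])
  -- the weight and the chain read on `Tor P`
  have hsupT : ∀ z : Tor P, lam * W (e.symm z) ≤
      ∑ ν, t ^ 2 * ((W (e.symm z) - W (e.symm (z - unitVec P ν))) + (W (e.symm z) - W (e.symm (z + unitVec P ν)))) + m * W (e.symm z) := fun z => by
    simp only [hsh', hush']
    rw [← sum_sumElim_eq']
    exact hsup _
  have hφT : ∀ j < k, ∀ z : Tor P, ∑ ν, t ^ 2 * ((φ (j + 1) (e.symm z) - φ (j + 1) (e.symm (z - unitVec P ν))) +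
      (φ (j + 1) (e.symm z) - φ (j + 1) (e.symm (z + unitVec P ν)))) + m * φ (j + 1) (e.symm z) = φ j (e.symm z) := fun j hj z => by
    simp only [hsh', hush']
    rw [← sum_sumElim_eq']
    exact hφ j hj _
  have h := chain_apply_le_weighted P t hm hc₀ hlam (W := fun z => W (e.symm z)) (fun z => hW _) hsupT
    (φ := fun j z => φ j (e.symm z)) hφT (e x₀)
  simp only [Equiv.symm_apply_apply] at h
  have hsum : ∑ y : Tor P, c₀ * φ 0 (e.symm y) ^ 2 / W (e.symm y) = ∑ y : TSite d P, c₀ * φ 0 y ^ 2 / W y :=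
    Equiv.sum_comp e.symm (fun y => c₀ * φ 0 y ^ 2 / W y)
  rwa [hsum] at h

/-- **(D-FS) ON `TSite d P` WITH THE `cosh` WEIGHT CENTRED AT THE OUTPUT SITE** (`B9Eq342CoshWeightSite`: `W > 0`, `W(x₀) = 1`, supersolution with
`λ = m − 2d·t²(cosh a − 1)`); `0 < λ` a HYPOTHESIS (`exists_rate`): `φ_k(x₀) ≤ √(ḡ_k·λ^{−k}∕c₀)·√(Σ_y c₀φ₀(y)²∕W_{x₀}(y))`.
[cite: Balaban1985BackgroundPropagators, Thm 3.1 (3.42) p.397, (3.11) p.392; Balaban1984PropagatorsI, (1.29) p.23, Prop. 1.1 p.33, p.36] -/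
theorem chain_apply_le_cosh_site (a t : ℝ) {m c₀ : ℝ} (hm : 0 < m) (hc₀ : 0 < c₀) (hlam : 0 < m - 2 * d * t ^ 2 * (Real.cosh a - 1))
    {k : ℕ} {φ : ℕ → TSite d P → ℝ}
    (hφ : ∀ j < k, ∀ x, ∑ i : Fin d ⊕ Fin d, t ^ 2 * (φ (j + 1) x - φ (j + 1) (Sum.elim (fun ν => unshift ν x) (fun ν => shift ν x) i)) +
      m * φ (j + 1) x = φ j x) (x₀ : TSite d P) :
    φ k x₀ ≤ Real.sqrt ((∑ p : Tor P, (((∑ ν, t ^ 2 * (2 - 2 * (chi P p (unitVec P ν)).re)) + m) ^ k)⁻¹) / Fintype.card (Tor P) *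
        ((m - 2 * d * t ^ 2 * (Real.cosh a - 1)) ^ k)⁻¹ / c₀) *
      Real.sqrt (∑ y, c₀ * φ 0 y ^ 2 /
        ∏ μ, Real.cosh (a * (circAbs (P μ) (((((x₀ μ : ℕ) : ZMod (P μ)) - ((y μ : ℕ) : ZMod (P μ))).val : ℕ) : ℤ) : ℝ))) := by
  have h := chain_apply_le_weighted_site P t hm hc₀ hlam
    (W := fun y => ∏ μ, Real.cosh (a * (circAbs (P μ) (((((x₀ μ : ℕ) : ZMod (P μ)) - ((y μ : ℕ) : ZMod (P μ))).val : ℕ) : ℤ) : ℝ)))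
    (fun y => weight_site_pos P a x₀ y) (fun y => weight_site_supersolution P a t m x₀ y) hφ x₀
  rw [weight_site_centre P a x₀, mul_one] at h
  exact h

/-- **THE BINDER `hDFS` OF THE (D-A) ASSEMBLY, INHABITED** (`t = η⁻¹`, `m = 1`, the `cosh` weight centred at `x₀`, `0 < λ = 1 − 2d·η⁻²(cosh a − 1)`):
for every `k`-chain `ψ` in the graph form, `ψ_k(x₀) ≤ C₃·√(Σ_y c₀ψ₀(y)²∕W_{x₀}(y))` with `C₃ = √(ḡ_k(η⁻¹,1)·λ^{−k}∕c₀)` — LITERALLY the hypothesis of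
`B9Eq342GreenPrimeSupBoundDecay.norm_GpOfU_apply_le_decay ∕ _rowSum` (level-free for `k ≥ d` by leaf-02's `entry_const_diag_le`).
[cite: Balaban1985BackgroundPropagators, Thm 3.1 (3.42) p.397, (3.23) p.394; Balaban1984PropagatorsI, Prop. 1.1 p.33] -/
theorem hDFS_cosh_site (a η : ℝ) {c₀ : ℝ} (hc₀ : 0 < c₀) (hlam : 0 < 1 - 2 * d * (η⁻¹) ^ 2 * (Real.cosh a - 1)) (k : ℕ) (x₀ : TSite d P) :
    ∀ ψ : ℕ → TSite d P → ℝ, (∀ j < k, ∀ x, ∑ i : Fin d ⊕ Fin d,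
        (η⁻¹) ^ 2 * (ψ (j + 1) x - ψ (j + 1) (Sum.elim (fun μ => unshift μ x) (fun μ => shift μ x) i)) + 1 * ψ (j + 1) x = ψ j x) →
      ψ k x₀ ≤ Real.sqrt ((∑ p : Tor P, (((∑ ν, (η⁻¹) ^ 2 * (2 - 2 * (chi P p (unitVec P ν)).re)) + 1) ^ k)⁻¹) / Fintype.card (Tor P) *
          ((1 - 2 * d * (η⁻¹) ^ 2 * (Real.cosh a - 1)) ^ k)⁻¹ / c₀) *
        Real.sqrt (∑ y, c₀ * ψ 0 y ^ 2 /
          ∏ μ, Real.cosh (a * (circAbs (P μ) (((((x₀ μ : ℕ) : ZMod (P μ)) - ((y μ : ℕ) : ZMod (P μ))).val : ℕ) : ℤ) : ℝ))) :=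
  fun _ hψ => chain_apply_le_cosh_site P a η⁻¹ one_pos hc₀ hlam hψ x₀

/-! ## The crude volume-free value of the spectral constant: `ḡ_k ≤ m^{−k}` -/

/-- **`ḡ_k = |T|⁻¹Σ_p(Δ_t(p)+m)^{−k} ≤ m^{−k}`** (`Δ_t(p) ≥ 0`): a VOLUME-FREE bound with no Fourier zone sum (the level-free diagonal value `3^d∕c₁·c₀`
for `k ≥ d` is ne9-leaf-02's `B5Eq129FreeResolventZoneSumLetters.entry_const_diag_le`; this crude one suffices at the top level, where `c₀` is a
function of `L` only). [folklore] [cite: Balaban1984PropagatorsI, (1.29) p.23, Prop. 1.1 p.33] -/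
theorem symbolSum_div_card_le (t : ℝ) {m : ℝ} (hm : 0 < m) (k : ℕ) :
    (∑ p : Tor P, (((∑ ν, t ^ 2 * (2 - 2 * (chi P p (unitVec P ν)).re)) + m) ^ k)⁻¹) / Fintype.card (Tor P) ≤ (m ^ k)⁻¹ := by
  have hcard : (0 : ℝ) < Fintype.card (Tor P) := by exact_mod_cast Fintype.card_pos
  rw [div_le_iff₀ hcard]
  have hterm : ∀ p : Tor P, (((∑ ν, t ^ 2 * (2 - 2 * (chi P p (unitVec P ν)).re)) + m) ^ k)⁻¹ ≤ (m ^ k)⁻¹ := fun p =>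
    inv_anti₀ (pow_pos hm k) (pow_le_pow_left₀ hm.le (by linarith [symbol_nonneg P t p]) k)
  calc ∑ p : Tor P, (((∑ ν, t ^ 2 * (2 - 2 * (chi P p (unitVec P ν)).re)) + m) ^ k)⁻¹ ≤ ∑ _p : Tor P, (m ^ k)⁻¹ :=
        Finset.sum_le_sum fun p _ => hterm p
    _ = (m ^ k)⁻¹ * Fintype.card (Tor P) := by rw [Finset.sum_const, Finset.card_univ, nsmul_eq_mul, mul_comm]

/-- **THE BINDER `hDFS` WITH A `Tor`-FREE CONSTANT** (`t = η⁻¹`, `m = 1`, `cosh` weight, `0 < λ`): `ψ_k(x₀) ≤ √(λ^{−k}∕c₀)·√(Σ_y c₀ψ₀(y)²∕W_{x₀}(y))` —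
`hDFS_cosh_site` with `ḡ_k ≤ 1`; VOLUME-FREE as displayed. [cite: Balaban1985BackgroundPropagators, Thm 3.1 (3.42) p.397; Balaban1984PropagatorsI, Prop. 1.1 p.33] -/
theorem hDFS_cosh_site' (a η : ℝ) {c₀ : ℝ} (hc₀ : 0 < c₀) (hlam : 0 < 1 - 2 * d * (η⁻¹) ^ 2 * (Real.cosh a - 1)) (k : ℕ) (x₀ : TSite d P) :
    ∀ ψ : ℕ → TSite d P → ℝ, (∀ j < k, ∀ x, ∑ i : Fin d ⊕ Fin d,
        (η⁻¹) ^ 2 * (ψ (j + 1) x - ψ (j + 1) (Sum.elim (fun μ => unshift μ x) (fun μ => shift μ x) i)) + 1 * ψ (j + 1) x = ψ j x) →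
      ψ k x₀ ≤ Real.sqrt (((1 - 2 * d * (η⁻¹) ^ 2 * (Real.cosh a - 1)) ^ k)⁻¹ / c₀) *
        Real.sqrt (∑ y, c₀ * ψ 0 y ^ 2 /
          ∏ μ, Real.cosh (a * (circAbs (P μ) (((((x₀ μ : ℕ) : ZMod (P μ)) - ((y μ : ℕ) : ZMod (P μ))).val : ℕ) : ℤ) : ℝ))) := by
  intro ψ hψ
  refine (hDFS_cosh_site P a η hc₀ hlam k x₀ ψ hψ).trans (mul_le_mul_of_nonneg_right (Real.sqrt_le_sqrt ?_) (Real.sqrt_nonneg _))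
  have h1 := symbolSum_div_card_le P η⁻¹ one_pos k
  rw [one_pow, inv_one] at h1
  have hl : 0 ≤ ((1 - 2 * d * (η⁻¹) ^ 2 * (Real.cosh a - 1)) ^ k)⁻¹ := inv_nonneg.2 (pow_nonneg hlam.le k)
  have h2 := div_le_div_of_nonneg_right (mul_le_mul_of_nonneg_right h1 hl) hc₀.le
  rwa [one_mul] at h2

end Literature.MathematicalPhysics.QuantumFieldTheory.Balaban1983to89.B5Eq129FreeResolventDecayedLetterSite

end
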